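import Literature.Probability.NegativeDependence.FederMihail
import HarnessLib

/-!
# `X ↑ Y ⟹ Y ↑ X` for a binary variable `X` (Pemantle, Prop. 1.2)

R. Pemantle, *Towards a theory of negative dependence*, J. Math. Phys. 41 (2000), §1 (held
`paper:arxiv-math_0404095`, p. 3), verbatim: "[…] a stronger property, called negative regression
dependence […] is defined by requiring the conditional distribution of `X` given `Y` to be stochastically
decreasing in `Y`: `P(X ≥ t | Y = s)` is decreasing in `s` for each `t`." (so `X ↑ Y` means `P(X ≥ t | Y = s)`
is increasing in `s`), and

> **Proposition 1.2.** Let `X` be a `{0,1}`-valued random variable and `Y` take values in any totally ordered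
> set. If `X ↑ Y` then `Y ↑ X`.
> *Proof:* Choose `t` in the range of `Y`. Since `P(X = 1 ‖ Y)` is increasing in `Y`, it follows that
> `P(X = 1 ‖ Y ≤ t) ≤ sup_{s ≤ t} P(X = 1 ‖ Y = s) ≤ inf_{s > t} P(X = 1 ‖ Y = s) ≤ P(X = 1 ‖ Y > t)`. Thus `X`
> and `𝟏_{Y > t}` are positively correlated and `P(Y > t ‖ X = 1) ≥ P(Y > t ‖ X = 0)`. This holding for all `t`
> is equivalent to `Y ↑ X`.

## Formalization (a weight `μ` on `2^σ`, `X = X_e = 𝟏[e ∈ S]`, `Y : 2^σ → β`, `β` a linear order)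

Conditional probabilities are cross-multiplied so that nothing is divided (levels of `Y` of mass zero are
allowed): `X ↑ Y` is `μ(X = 1, Y = s)·μ(Y = s') ≤ μ(X = 1, Y = s')·μ(Y = s)` for `s ≤ s'`, and the conclusion
`Y ↑ X` is `μ(Y > t, X = 0)·μ(X = 1) ≤ μ(Y > t, X = 1)·μ(X = 0)` for every `t`. The proof is the printed
comparison organised as a double sum over the levels `s ≤ t < s'` (no sign assumption on `μ` is needed).

## References

* [Pemantle2000] R. Pemantle, Towards a theory of negative dependence, J. Math. Phys. 41 (2000) 1371–1390 —
  §1, Prop. 1.2.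
-/

noncomputable section

open Finset

universe u

namespace Literature.Probability.NegativeDependence

variable {σ : Type u} [Fintype σ] [DecidableEq σ] {β : Type*} [LinearOrder β]

/-- **Pemantle, Proposition 1.2: `X ↑ Y ⟹ Y ↑ X` for binary `X`.** With `X = 𝟏[e ∈ S]` and
`Y : 2^σ → β`: if `μ(X = 1 | Y = s)` is increasing in `s` (cross-multiplied: for `s ≤ s'`,
`μ(Y = s, X = 1)·μ(Y = s') ≤ μ(Y = s', X = 1)·μ(Y = s)`), then for every `t`,
`μ(Y > t | X = 1) ≥ μ(Y > t | X = 0)` (cross-multiplied: `μ(Y > t, X = 0)·μ(X = 1) ≤ μ(Y > t, X = 1)·μ(X = 0)`).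
[cite: Pemantle2000, §1 Prop. 1.2] -/
theorem Pemantle_prop_1_2 (μ : Finset σ → ℝ) (e : σ) (Y : Finset σ → β)
    (h : ∀ s s' : β, s ≤ s' →
      (∑ S ∈ Finset.univ.filter (fun S => Y S = s ∧ e ∈ S), μ S) *
          (∑ S ∈ Finset.univ.filter (fun S => Y S = s'), μ S) ≤
        (∑ S ∈ Finset.univ.filter (fun S => Y S = s' ∧ e ∈ S), μ S) *
          (∑ S ∈ Finset.univ.filter (fun S => Y S = s), μ S))
    (t : β) :
    (∑ S ∈ Finset.univ.filter (fun S => t < Y S ∧ e ∉ S), μ S) *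
        (∑ S ∈ Finset.univ.filter (fun S => e ∈ S), μ S) ≤
      (∑ S ∈ Finset.univ.filter (fun S => t < Y S ∧ e ∈ S), μ S) *
        (∑ S ∈ Finset.univ.filter (fun S => e ∉ S), μ S) := by
  -- the levels of `Y` and the level masses `a_s = μ(Y = s, X = 1)`, `b_s = μ(Y = s, X = 0)`
  set V : Finset β := Finset.univ.image Y with hV
  set a : β → ℝ := fun s => ∑ S ∈ Finset.univ.filter (fun S => Y S = s ∧ e ∈ S), μ S with ha
  set b : β → ℝ := fun s => ∑ S ∈ Finset.univ.filter (fun S => Y S = s ∧ e ∉ S), μ S with hb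
  -- `μ(Y = s) = a_s + b_s`
  have hsplit : ∀ s : β, ∑ S ∈ Finset.univ.filter (fun S => Y S = s), μ S = a s + b s := by
    intro s
    rw [ha, hb, ← Finset.sum_filter_add_sum_filter_not (Finset.univ.filter fun S => Y S = s) (fun S => e ∈ S),
      Finset.filter_filter, Finset.filter_filter]
  -- the hypothesis, unravelled: `a_s b_{s'} ≤ a_{s'} b_s` for `s ≤ s'`
  have hab : ∀ s s' : β, s ≤ s' → a s * b s' ≤ a s' * b s := by
    intro s s' hss'
    have key := h s s' hss'
    rw [hsplit, hsplit] at key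
    change a s * (a s' + b s') ≤ a s' * (a s + b s) at key
    nlinarith [key]
  -- fibrewise decompositions over the levels
  have hfib : ∀ (p : Finset σ → Prop) [DecidablePred p] (q : β → Prop) [DecidablePred q],
      (∀ S, p S → q (Y S)) →
      ∑ S ∈ Finset.univ.filter p, μ S =
        ∑ s ∈ V.filter q, ∑ S ∈ Finset.univ.filter (fun S => Y S = s ∧ p S), μ S := by
    intro p _ q _ hpq
    rw [← Finset.sum_fiberwise_of_maps_to (s := Finset.univ.filter p) (t := V.filter q) (g := Y)
      (fun S hS => Finset.mem_filter.2 ⟨Finset.mem_image_of_mem Y (Finset.mem_univ S),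
        hpq S (Finset.mem_filter.1 hS).2⟩)]
    refine Finset.sum_congr rfl fun s _ => ?_
    rw [Finset.filter_filter]
    exact Finset.sum_congr (Finset.filter_congr fun S _ => by tauto) fun _ _ => rfl
  -- `μ(Y > t, X = 1) = Σ_{s > t} a_s`, etc.
  have hA : ∑ S ∈ Finset.univ.filter (fun S => t < Y S ∧ e ∈ S), μ S = ∑ s ∈ V.filter (fun s => t < s), a s := by
    rw [hfib (fun S => t < Y S ∧ e ∈ S) (fun s => t < s) fun S hS => hS.1]
    refine Finset.sum_congr rfl fun s hs => ?_
    have hts : t < s := (Finset.mem_filter.1 hs).2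
    exact Finset.sum_congr (Finset.filter_congr fun S _ => ⟨fun hS => ⟨hS.1, hS.2.2⟩,
      fun hS => ⟨hS.1, hS.1 ▸ hts, hS.2⟩⟩) fun _ _ => rfl
  have hB : ∑ S ∈ Finset.univ.filter (fun S => t < Y S ∧ e ∉ S), μ S = ∑ s ∈ V.filter (fun s => t < s), b s := by
    rw [hfib (fun S => t < Y S ∧ e ∉ S) (fun s => t < s) fun S hS => hS.1]
    refine Finset.sum_congr rfl fun s hs => ?_
    have hts : t < s := (Finset.mem_filter.1 hs).2
    exact Finset.sum_congr (Finset.filter_congr fun S _ => ⟨fun hS => ⟨hS.1, hS.2.2⟩,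
      fun hS => ⟨hS.1, hS.1 ▸ hts, hS.2⟩⟩) fun _ _ => rfl
  have hA' : ∑ S ∈ Finset.univ.filter (fun S => e ∈ S), μ S = ∑ s ∈ V.filter (fun _ => True), a s := by
    rw [hfib (fun S => e ∈ S) (fun _ => True) fun S _ => trivial]
  have hB' : ∑ S ∈ Finset.univ.filter (fun S => e ∉ S), μ S = ∑ s ∈ V.filter (fun _ => True), b s := by
    rw [hfib (fun S => e ∉ S) (fun _ => True) fun S _ => trivial]
  have hVT : V.filter (fun _ => True) = V := Finset.filter_true_of_mem fun _ _ => trivial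
  rw [hA, hB, hA', hB', hVT, ← Finset.sum_filter_add_sum_filter_not V (fun s => t < s) a,
    ← Finset.sum_filter_add_sum_filter_not V (fun s => t < s) b]
  -- it remains: `(Σ_{s'>t} b)(Σ_{s≤t} a) ≤ (Σ_{s'>t} a)(Σ_{s≤t} b)`
  have hcross : (∑ s' ∈ V.filter (fun s => t < s), b s') * (∑ s ∈ V.filter (fun s => ¬t < s), a s) ≤
      (∑ s' ∈ V.filter (fun s => t < s), a s') * ∑ s ∈ V.filter (fun s => ¬t < s), b s := by
    rw [Finset.sum_mul_sum, Finset.sum_mul_sum]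
    refine Finset.sum_le_sum fun s' hs' => Finset.sum_le_sum fun s hs => ?_
    have hts' : t < s' := (Finset.mem_filter.1 hs').2
    have hst : s ≤ t := not_lt.1 (Finset.mem_filter.1 hs).2
    rw [mul_comm (b s')]
    exact hab s s' (hst.trans hts'.le)
  nlinarith [hcross]

end Literature.Probability.NegativeDependence

end
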